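import Summits.QuantumFields.YangMills.Theorems.BalabanUVNodesN15TwoSpacingGluingRecordKnitEntryThreeDefect
import Summits.QuantumFields.YangMills.Theorems.BalabanUVNodesN15TwoSpacingGluingNeumannKnitDefectRecordRows
import Summits.QuantumFields.YangMills.Theorems.BalabanUVNodesN15NeumannCubeLiftEntryThree
import HarnessLib

/-!
# THE GLUING STEP AT TWO LATTICE SPACINGS, 86R ∕ 88R: ENTRY 3 OF THE COVER's PARAMETRIX ON THE TORUS OF RECORD — `(Σ_μ∇′*_μ∇′_μ)∘G₀′` DECAYS AT THE FINE SPACING `L^r·L^K` AND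
# `𝔇((Σ∇′*∇′)G₀′, (Σ∇*∇)G₀) ≤ D(L^K)^{−1∕16}e^{−δd}` — CUBES OF FIXED SIDE `L^{s+1}` LIFTED FROM THEIR DOUBLED TORUS, THE VOLUME `2L^{m_T}` FREE
# (dag-n15-w5 g5 for dag-n15-c's programme R; N15 = NE2, s1 «background-layer OPERATOR ingredient»)

Cell `pub-ymgap`, seat `pub-ymgap-dag-n15-w5` (WIDTH SEAT w5 on node n15, g5; HUMAN RULING D-0062 ∕ director-ym R399 (3a); dag-n15-c g14's word «n15-w5 take 86R–88R»).
`--kind proof --supports stmt-QuantumFields-27366 --as helper`, COUNT-NEUTRAL.  Theorems only (0 `def`, 0 `sorry`).  Imports BY NAME 87R `…RecordKnitEntryThreeDefect` (★★★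
`hasMaj_idef_commOp_lapOp_comp_knitGR`; through it FILE 88∕87 `entryThreeDefectConst_le` ∕ `rpow_sixteenth_facts`, FILE 86, FILE 83 `hasMaj_comp_parametrix_of_commOp_h` ∕
`hasMaj_idef_comp_parametrix_of_commOp_h`, FILE 72 `hasMaj_commOp_lapOp_comp_cover_of` ∕ `mem_intBonds_of_hcube_ne_zero_side` ∕ `sum_ind_cubeBlocks_le_overlap`, FILE 69 `hasMaj_rate_le` ∕
`bgrad_eq_neg_symbOp`, FILE 67 `abs_coverH_le_one` ∕ `abs_coverH_fine_sub_le`, FILE 73 `knitHR` ∕ `knitGR` ∕ `MP_eq_two_mul` ∕ `coverMargin_fit`, dag-n15-a P-IId `hasMaj_chiCube_liftCubeG_fine` ∕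
`hasMaj_chiCube_divAdjOut_liftCubeG_pair`), FILE 81 `…NeumannKnitDefectRecordRows` (`liftCubeG_grad_row_fine`: the fine forward-difference cut row of a lifted cube) and dag-n15-w5 g4
`…NeumannCubeLiftEntryThree` (`hasMaj_mulOp_lap_liftCubeG_pair`: the weighted entry-3 rows of the lifted cubes, both spacings, every letter discharged; `hasMaj_idef_mulOp_lap_liftCubeG`: their
two-grid η-defect for a pair of weights with a fit); nothing in the tree is modified or re-proved.

WHAT.  Torus of record `M = MP (paramsOf d L m_T K hL)` (`M_ν = 2L^{m_T} = 2·L^{m_T−s}·L^s`), FILE 73's cover: partition `knitHR` (modulus `2q`, `q = L^{m_T−s}`, resolution `w = L^s`, margin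
`coverMargin L s`), cubes `knitGR … k = liftCubeG … (coverCorner …) (L^{s+1}) a` (side `L^{s+1}`, `s + 1 ≤ m_T`), the local Laplacian `D₃ = lapOp n (bshiftEquiv) 0 = Σ_μ∇*_μ∇_μ` at the coarse
spacing `L^K` and the FINE spacing `n = L^r·L^K` (blocks through King's pairing `P`; `r = 0` is the coarse member):
* §1 ★★★ **`hasMaj_lap_parametrix_knitR`** (86R) — `∃ δ A > 0 ∀ s m_T K r (s + 1 ≤ m_T, K ≥ 1): D₃′∘G₀′ ≤ A·e^{−δ|y−y′|_T}` for the record knit: FILE 83 `hasMaj_comp_parametrix_of_commOp_h`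
  with g4's weighted rows at `h := knitHR … k` (side condition FILE 72 `mem_intBonds_of_hcube_ne_zero_side` in FILE 73's `hfit1`∕`hS` pattern), FILE 72's commutator rows on P-IId's ∕ FILE 81's
  fine cut rows, the TRUE overlap `(L+1)^{d+1}` (FILE 72 `sum_ind_cubeBlocks_le_overlap`, `L^{s+1}∕L^s + 1 = L + 1`) — `δ, A` free of `s, m_T, K, r`;
* §2 ★★★ **`hasMaj_idef_lap_parametrix_knitR`** (88R) — `∃ δ D > 0 ∀ s m_T K r (s + 1 ≤ m_T, K ≥ 1, 4 ≤ L^K): 𝔇(D₃′∘G₀′, D₃∘G₀) ≤ D·(L^K)^{−1∕16}·e^{−δ|y−y′|_T}`: FILE 83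
  `hasMaj_idef_comp_parametrix_of_commOp_h` with §1's fine rows, g4's weighted-row defect at the pair `(knitHR … (L^K), knitHR … (L^r·L^K))` (fit FILE 67 `abs_coverH_fine_sub_le`,
  `o = π(d+1)∕(L^K·L^s) ≤ π(d+1)·(L^K)^{−1∕16}`), and 87R's commutator defect; compression FILE 87 `entryThreeDefectConst_le` — `δ, D` free of `s, m_T, K, r`.
FILE 86 `hasMaj_lap_parametrix_knit` ∕ FILE 88 `hasMaj_idef_lap_parametrix_knit`'s record twins (`(m+1, k) ↦ (m_T, K)`, `knitH∕knitG ↦ knitHR∕knitGR`, ∃-prefixes copied literally); FILE 92R's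
binders `H3` ∕ `H3d`.

HONEST FRAMING ∕ LIMITS.  Block-majorant bookkeeping over LANDED rows at `U ≡ 1` (Neumann-by-images cubes lifted to the torus of record); no new analytic estimate.  Nothing of
[B5]∕[B6]∕[B9] asserted ([B6] (2.133)–(2.136) p.247 shapes; [B9] (3.42) p.397 entry 3's shape).  NE2⁺ NOT PRINTED, NOT proved; N15 NOT discharged; K3⁸ OPEN; counts of record UNMOVED
(typed 28∕28 · discharged 5∕27); one finite 𝕋⁴ at fixed ε per index — NOT infinite volume, NOT OS on ℝ⁴, NOT a mass gap, NOT Clay; R4 closes the conditional finite-𝕋⁴ rung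
`BalabanLadder.UV` only.  No summit statement is proved here.  Restate-immune (no Theses import).
-/

noncomputable section

/-! ## §1 `(Σ∇′*∇′)∘G₀′` decays on the torus of record (86R) -/

namespace Summit.QuantumFields.YangMills.BalabanUVNodes.N15.Gluing

open Real
open Literature.MathematicalPhysics.QuantumFieldTheory.Balaban1983to89
open Literature.MathematicalPhysics.QuantumFieldTheory.Balaban1983to89.B5Prop11Plancherel (Tor fine)
open Literature.MathematicalPhysics.QuantumFieldTheory.Balaban1983to89.B11SectG (BlockNorm HasMaj RowSum)
open Literature.MathematicalPhysics.QuantumFieldTheory.Balaban1983to89.T4EtaRateDefect (idef idef_sub)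
open Literature.MathematicalPhysics.QuantumFieldTheory.Balaban1983to89.T4EtaRateCoeffDefect (pull)
open Literature.MathematicalPhysics.QuantumFieldTheory.Balaban1983to89.B6Prop26Gluing (mulOp mulOp_apply ind ind_nonneg ind_le_one)
open Literature.MathematicalPhysics.QuantumFieldTheory.Balaban1983to89.B6UnitTorusCarrier (unitTorusGeo triangle254_unitTorusGeo rowSum_unitTorusGeo unitTorusGeo_dist_nonneg
  unitTorusGeo_dist_self)
open Literature.MathematicalPhysics.QuantumFieldTheory.Balaban1983to89.B5SiteBridgeP12 (MP)
open Literature.MathematicalPhysics.QuantumFieldTheory.King1986.Torus (blockOf tdistT tdistT_nonneg)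
open Summit.QuantumFields.YangMills.BalabanUVNodes.N15.VectorPiece (bshiftEquiv kingPrV blkFine blkFine_comp_kingPrV)
open Summit.QuantumFields.YangMills.BalabanUVNodes.N15.BackgroundLayer (fgrad bgrad symbOp_sD_eq)
open Summit.QuantumFields.YangMills.BalabanUVNodes.N15.TwoGrid (paramsOf chiCube cubeBlocks liftCubeG MP_dvd_MP hasMaj_chiCube_liftCubeG_fine hasMaj_chiCube_divAdjOut_liftCubeG_pair
  hasMaj_mulOp_lap_liftCubeG_pair hasMaj_idef_mulOp_lap_liftCubeG)

variable {d : ℕ} {L : ℕ} [NeZero L]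

/-- ★★★ **ENTRY 3 OF THE COVER's PARAMETRIX ON THE TORUS OF RECORD, FINE MEMBER**: for odd `L ≥ 3`, `a > 0` there are `δ, A > 0` — free of the cube exponent `s`, the volume exponent
`m_T ≥ s + 1`, the spacing exponent `K ≥ 1` and the refinement `r` — with `(Σ_μ∇′*_μ∇′_μ)∘G₀′ ≤ A·e^{−δ|y−y′|_T}` at the spacing `L^r·L^K` of `Tor(2L^{m_T})` (blocks read through King's
pairing; `r = 0` gives the coarse member) — FILE 83 `hasMaj_comp_parametrix_of_commOp_h` with dag-n15-w5 g4's weighted rows `M_{h_k}D₃G^{↑}(□_k) ≤ 1_□1_□β₃e^{−δd}` at `h := knitHR … k` and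
FILE 72's commutator rows `[D₃, M_{h_k}]G^{↑}(□_k)` on dag-n15-a's ∕ FILE 81's fine cut rows, summed over the cover with the true overlap `(L+1)^{d+1}`.
[cite: Balaban1984PropagatorsII, (2.133), (2.136) p.247 (shapes + mechanism), (2.36)–(2.38) p.229, p.238 (T_□); Balaban1985BackgroundPropagators, (3.42) p.397 (entry 3: shape);
Balaban1984PropagatorsI, Prop. 1.2 (1.110) p.35, (1.126) p.38] -/
theorem hasMaj_lap_parametrix_knitR (hL : Odd L ∧ 1 < L) {a : ℝ} (ha : 0 < a) :
    ∃ δ A : ℝ, 0 < δ ∧ 0 < A ∧ ∀ (s mT K r : ℕ) (hs : s + 1 ≤ mT) (_hK : 1 ≤ K),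
      HasMaj (BlockNorm.ofBlocks (unitTorusGeo L K (MP (paramsOf d L mT K hL)))
          (fun i : Tor (fine (L ^ r * L ^ K) (MP (paramsOf d L mT K hL))) × Fin (d + 1) => blockOf (L ^ r * L ^ K) (MP (paramsOf d L mT K hL)) i.1))
        (BlockNorm.ofBlocks (unitTorusGeo L K (MP (paramsOf d L mT K hL)))
          (fun i : Tor (fine (L ^ r * L ^ K) (MP (paramsOf d L mT K hL))) × Fin (d + 1) => blockOf (L ^ r * L ^ K) (MP (paramsOf d L mT K hL)) i.1))
        (lapOp ((L ^ r * L ^ K : ℕ) : ℝ) (bshiftEquiv (MP (paramsOf d L mT K hL)) (L ^ r * L ^ K)) 0 ∘ₗ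
          parametrix (knitHR d L s mT K (L ^ r * L ^ K) hL) (knitGR d L s mT K (L ^ r * L ^ K) hL hs a))
        (fun y y' => A * Real.exp (-(δ * tdistT (MP (paramsOf d L mT K hL)) y y'))) := by
  have hL3 : 3 ≤ L := by obtain ⟨⟨j, hj⟩, h1⟩ := hL; omega
  have hLpos : 0 < L := by omega
  -- the letters, all uniform in the volume: g4's weighted entry-3 rows, P-IId's and FILE 81's fine cut rows
  obtain ⟨δE, βE, hδE, hβE, HE⟩ := hasMaj_mulOp_lap_liftCubeG_pair (d := d) hL ha
  obtain ⟨δG, βG, hδG, hβG, HG⟩ := hasMaj_chiCube_liftCubeG_fine (d := d) hL ha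
  obtain ⟨δD, βD, hδD, hβD, HD⟩ := liftCubeG_grad_row_fine (d := d) hL ha
  obtain ⟨δB, βB, hδB, hβB, HB⟩ := hasMaj_chiCube_divAdjOut_liftCubeG_pair (d := d) hL ha
  set δ : ℝ := min (min δE δG) (min δD δB) with hδ_def
  have hδ : 0 < δ := lt_min (lt_min hδE hδG) (lt_min hδD hδB)
  have hdE : δ ≤ δE := (min_le_left _ _).trans (min_le_left _ _)
  have hdG : δ ≤ δG := (min_le_left _ _).trans (min_le_right _ _)
  have hdD : δ ≤ δD := (min_le_right _ _).trans (min_le_left _ _)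
  have hdB : δ ≤ δB := (min_le_right _ _).trans (min_le_right _ _)
  set β₁ : ℝ := max βD βB with hβ₁_def
  have hβ₁ : 0 ≤ β₁ := hβD.le.trans (le_max_left _ _)
  set Θ : ℝ := (d + 1 : ℕ) * (32 * π ^ 2 * βG + 2 * (π * β₁)) with hΘ_def
  have hΘ : 0 ≤ Θ := by positivity
  set Nov : ℝ := ((((L + 1) ^ (d + 1) : ℕ)) : ℝ) with hNov_def
  have hNov : 0 ≤ Nov := by positivity
  refine ⟨δ, Nov * (βE + Θ) + 1, hδ, by positivity, fun s mT K r hs hK => ?_⟩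
  set M : Fin (d + 1) → ℕ := MP (paramsOf d L mT K hL) with hMdef
  have hs' : s ≤ mT := by omega
  have hM : ∀ ν, M ν = 2 * L ^ (mT - s) * L ^ s := MP_eq_two_mul L s mT K hL hs'
  have hw : 0 < L ^ s := pow_pos hLpos s
  haveI : NeZero (L ^ (mT - s)) := ⟨pow_ne_zero _ (NeZero.ne L)⟩
  have hwR : (1 : ℝ) ≤ ((L ^ s : ℕ) : ℝ) := by exact_mod_cast hw
  have hSe : L ^ (s + 1) = L * L ^ s := by rw [pow_succ, mul_comm]
  have hfit : 2 * coverMargin L s + 2 * L ^ s + 1 ≤ L ^ (s + 1) := by rw [hSe]; exact coverMargin_fit hL3 s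
  have hfit1 : coverMargin L s + 2 * L ^ s + 1 ≤ L ^ (s + 1) := by omega
  have hS : L ^ (s + 1) ≤ 2 * L ^ (mT - s) * L ^ s := by
    rw [← hM 0]
    show L ^ (s + 1) ≤ 2 * L ^ mT
    have := Nat.pow_le_pow_right hLpos hs
    omega
  have hind : ∀ (k : Fin (d + 1) → ZMod (2 * L ^ (mT - s))) (y y' : Tor M),
      0 ≤ ind (g := unitTorusGeo L K M) ((cubeBlocks M (coverCorner M (L ^ s) (L ^ (mT - s)) (coverMargin L s) k) (L ^ (s + 1)) : Finset (Tor M)) : Set (Tor M)) y *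
        ind (g := unitTorusGeo L K M) ((cubeBlocks M (coverCorner M (L ^ s) (L ^ (mT - s)) (coverMargin L s) k) (L ^ (s + 1)) : Finset (Tor M)) : Set (Tor M)) y' :=
    fun k y y' => mul_nonneg (ind_nonneg _ _) (ind_nonneg _ _)
  -- the weighted entry-3 rows of the lifted cubes at `h := knitHR … k` (g4), rate weakened to `δ`
  have hE3 : ∀ k : Fin (d + 1) → ZMod (2 * L ^ (mT - s)),
      HasMaj (BlockNorm.ofBlocks (unitTorusGeo L K M) (fun i : Tor (fine (L ^ r * L ^ K) M) × Fin (d + 1) => blockOf (L ^ r * L ^ K) M i.1))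
        (BlockNorm.ofBlocks (unitTorusGeo L K M) (fun i : Tor (fine (L ^ r * L ^ K) M) × Fin (d + 1) => blockOf (L ^ r * L ^ K) M i.1))
        (mulOp (knitHR d L s mT K (L ^ r * L ^ K) hL k) ∘ₗ (lapOp ((L ^ r * L ^ K : ℕ) : ℝ) (bshiftEquiv M (L ^ r * L ^ K)) 0 ∘ₗ knitGR d L s mT K (L ^ r * L ^ K) hL hs a k))
        (fun y y' => ind ((cubeBlocks M (coverCorner M (L ^ s) (L ^ (mT - s)) (coverMargin L s) k) (L ^ (s + 1)) : Finset (Tor M)) : Set (Tor M)) y *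
          ind ((cubeBlocks M (coverCorner M (L ^ s) (L ^ (mT - s)) (coverMargin L s) k) (L ^ (s + 1)) : Finset (Tor M)) : Set (Tor M)) y' * (βE * Real.exp (-(δ * tdistT M y y')))) :=
    fun k =>
    hasMaj_rate_le (hind k) hβE.le hdE
      ((HE (s + 1) mT K r hs hK (coverCorner M (L ^ s) (L ^ (mT - s)) (coverMargin L s) k)).2 (knitHR d L s mT K (L ^ r * L ^ K) hL k)
        (fun b hb => mem_intBonds_of_hcube_ne_zero_side (m₀ := coverMargin L s) hM hw hfit1 hS hb) (fun b => abs_coverH_le_one k b))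
  -- the fine cut rows of the lifted cubes (P-IId, FILE 81) at the common rate `δ`
  have hGc' : ∀ k : Fin (d + 1) → ZMod (2 * L ^ (mT - s)),
      HasMaj (BlockNorm.ofBlocks (unitTorusGeo L K M) (fun i : Tor (fine (L ^ r * L ^ K) M) × Fin (d + 1) => blockOf (L ^ r * L ^ K) M i.1))
        (BlockNorm.ofBlocks (unitTorusGeo L K M) (fun i : Tor (fine (L ^ r * L ^ K) M) × Fin (d + 1) => blockOf (L ^ r * L ^ K) M i.1))
        (mulOp (chiCube M (L ^ r * L ^ K) (coverCorner M (L ^ s) (L ^ (mT - s)) (coverMargin L s) k) (L ^ (s + 1))) ∘ₗ knitGR d L s mT K (L ^ r * L ^ K) hL hs a k)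
        (fun y y' => ind ((cubeBlocks M (coverCorner M (L ^ s) (L ^ (mT - s)) (coverMargin L s) k) (L ^ (s + 1)) : Finset (Tor M)) : Set (Tor M)) y *
          ind ((cubeBlocks M (coverCorner M (L ^ s) (L ^ (mT - s)) (coverMargin L s) k) (L ^ (s + 1)) : Finset (Tor M)) : Set (Tor M)) y' * (βG * Real.exp (-(δ * tdistT M y y')))) :=
    fun k => hasMaj_rate_le (hind k) hβG.le hdG (HG (s + 1) mT K r hs hK (coverCorner M (L ^ s) (L ^ (mT - s)) (coverMargin L s) k))
  have hDc' : ∀ (k : Fin (d + 1) → ZMod (2 * L ^ (mT - s))) (μ : Fin (d + 1)),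
      HasMaj (BlockNorm.ofBlocks (unitTorusGeo L K M) (fun i : Tor (fine (L ^ r * L ^ K) M) × Fin (d + 1) => blockOf (L ^ r * L ^ K) M i.1))
        (BlockNorm.ofBlocks (unitTorusGeo L K M) (fun i : Tor (fine (L ^ r * L ^ K) M) × Fin (d + 1) => blockOf (L ^ r * L ^ K) M i.1))
        (mulOp (chiCube M (L ^ r * L ^ K) (coverCorner M (L ^ s) (L ^ (mT - s)) (coverMargin L s) k) (L ^ (s + 1))) ∘ₗ
          (fgrad ((L ^ r * L ^ K : ℕ) : ℝ) (bshiftEquiv M (L ^ r * L ^ K) μ) ∘ₗ knitGR d L s mT K (L ^ r * L ^ K) hL hs a k))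
        (fun y y' => ind ((cubeBlocks M (coverCorner M (L ^ s) (L ^ (mT - s)) (coverMargin L s) k) (L ^ (s + 1)) : Finset (Tor M)) : Set (Tor M)) y *
          ind ((cubeBlocks M (coverCorner M (L ^ s) (L ^ (mT - s)) (coverMargin L s) k) (L ^ (s + 1)) : Finset (Tor M)) : Set (Tor M)) y' * (β₁ * Real.exp (-(δ * tdistT M y y')))) :=
    fun k μ => by
    have h := HD (s + 1) mT K r hs hK (coverCorner M (L ^ s) (L ^ (mT - s)) (coverMargin L s) k) μ
    rw [symbOp_sD_eq] at h
    exact (hasMaj_rate_le (hind k) hβD.le hdD h).mono fun y y' =>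
      mul_le_mul_of_nonneg_left (mul_le_mul_of_nonneg_right (le_max_left _ _) (Real.exp_nonneg _)) (hind k y y')
  have hDbc' : ∀ (k : Fin (d + 1) → ZMod (2 * L ^ (mT - s))) (μ : Fin (d + 1)),
      HasMaj (BlockNorm.ofBlocks (unitTorusGeo L K M) (fun i : Tor (fine (L ^ r * L ^ K) M) × Fin (d + 1) => blockOf (L ^ r * L ^ K) M i.1))
        (BlockNorm.ofBlocks (unitTorusGeo L K M) (fun i : Tor (fine (L ^ r * L ^ K) M) × Fin (d + 1) => blockOf (L ^ r * L ^ K) M i.1))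
        (mulOp (chiCube M (L ^ r * L ^ K) (coverCorner M (L ^ s) (L ^ (mT - s)) (coverMargin L s) k) (L ^ (s + 1))) ∘ₗ
          (bgrad ((L ^ r * L ^ K : ℕ) : ℝ) (bshiftEquiv M (L ^ r * L ^ K) μ) ∘ₗ knitGR d L s mT K (L ^ r * L ^ K) hL hs a k))
        (fun y y' => ind ((cubeBlocks M (coverCorner M (L ^ s) (L ^ (mT - s)) (coverMargin L s) k) (L ^ (s + 1)) : Finset (Tor M)) : Set (Tor M)) y *
          ind ((cubeBlocks M (coverCorner M (L ^ s) (L ^ (mT - s)) (coverMargin L s) k) (L ^ (s + 1)) : Finset (Tor M)) : Set (Tor M)) y' * (β₁ * Real.exp (-(δ * tdistT M y y')))) :=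
    fun k μ => by
    have h := (HB (s + 1) mT K r hs hK (coverCorner M (L ^ s) (L ^ (mT - s)) (coverMargin L s) k) μ).2
    rw [bgrad_eq_neg_symbOp, LinearMap.neg_comp, LinearMap.comp_neg]
    exact ((hasMaj_rate_le (hind k) hβB.le hdB h).mono fun y y' =>
      mul_le_mul_of_nonneg_left (mul_le_mul_of_nonneg_right (le_max_right _ _) (Real.exp_nonneg _)) (hind k y y')).neg
  -- FILE 72's commutator rows, constants `∝ w⁻¹, w⁻²` bounded by `Θ`
  have hKc' : ∀ k : Fin (d + 1) → ZMod (2 * L ^ (mT - s)),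
      HasMaj (BlockNorm.ofBlocks (unitTorusGeo L K M) (fun i : Tor (fine (L ^ r * L ^ K) M) × Fin (d + 1) => blockOf (L ^ r * L ^ K) M i.1))
        (BlockNorm.ofBlocks (unitTorusGeo L K M) (fun i : Tor (fine (L ^ r * L ^ K) M) × Fin (d + 1) => blockOf (L ^ r * L ^ K) M i.1))
        (commOp (lapOp ((L ^ r * L ^ K : ℕ) : ℝ) (bshiftEquiv M (L ^ r * L ^ K)) 0) (knitHR d L s mT K (L ^ r * L ^ K) hL k) ∘ₗ knitGR d L s mT K (L ^ r * L ^ K) hL hs a k)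
        (fun y y' => ind ((cubeBlocks M (coverCorner M (L ^ s) (L ^ (mT - s)) (coverMargin L s) k) (L ^ (s + 1)) : Finset (Tor M)) : Set (Tor M)) y *
          ind ((cubeBlocks M (coverCorner M (L ^ s) (L ^ (mT - s)) (coverMargin L s) k) (L ^ (s + 1)) : Finset (Tor M)) : Set (Tor M)) y' * (Θ * Real.exp (-(δ * tdistT M y y')))) := fun k => by
    have h := hasMaj_commOp_lapOp_comp_cover_of (L := L) (kk := K) (M := M) (n := L ^ r * L ^ K) hM hw hfit1 hS k (hGc' k) (hDc' k) (hDbc' k)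
    refine h.mono fun y y' => mul_le_mul_of_nonneg_left (mul_le_mul_of_nonneg_right ?_ (Real.exp_nonneg _)) (hind k y y')
    have h32 : 32 * π ^ 2 / ((L ^ s : ℕ) : ℝ) ^ 2 * βG ≤ 32 * π ^ 2 * βG := by
      refine mul_le_mul_of_nonneg_right (div_le_self (by positivity) ?_) hβG.le
      nlinarith
    have hπ : π / ((L ^ s : ℕ) : ℝ) * β₁ ≤ π * β₁ := mul_le_mul_of_nonneg_right (div_le_self Real.pi_pos.le hwR) hβ₁
    rw [hΘ_def, add_zero]
    exact mul_le_mul_of_nonneg_left (by linarith) (by positivity)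
  -- the partition's size and the cover's true overlap `(L+1)^{d+1}`
  have hh : ∀ (k : Fin (d + 1) → ZMod (2 * L ^ (mT - s))) x, |knitHR d L s mT K (L ^ r * L ^ K) hL k x| ≤ 1 := fun k x => abs_coverH_le_one k x
  have hNovEq : L ^ (s + 1) / L ^ s + 1 = L + 1 := by rw [pow_succ, Nat.mul_div_cancel_left L hw]
  have hN : ∀ y : Tor M, ∑ k : Fin (d + 1) → ZMod (2 * L ^ (mT - s)),
      ind (g := unitTorusGeo L K M) ((cubeBlocks M (coverCorner M (L ^ s) (L ^ (mT - s)) (coverMargin L s) k) (L ^ (s + 1)) : Finset (Tor M)) : Set (Tor M)) y ≤ Nov := fun y => by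
    have := sum_ind_cubeBlocks_le_overlap (M := M) (w := L ^ s) (q := L ^ (mT - s)) (m₀ := coverMargin L s) (S := L ^ (s + 1)) hM hw L K y
    rwa [hNovEq] at this
  -- FILE 83
  have key := hasMaj_comp_parametrix_of_commOp_h (g := unitTorusGeo L K M) (fun i : Tor (fine (L ^ r * L ^ K) M) × Fin (d + 1) => blockOf (L ^ r * L ^ K) M i.1)
    (fun k => ((cubeBlocks M (coverCorner M (L ^ s) (L ^ (mT - s)) (coverMargin L s) k) (L ^ (s + 1)) : Finset (Tor M)) : Set (Tor M))) hβE.le hΘ hh hN hE3 hKc'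
  refine key.mono fun y y' => mul_le_mul_of_nonneg_right (by linarith [mul_nonneg hNov (add_nonneg hβE.le hΘ)]) (Real.exp_nonneg _)

/-! ## §2 The two-grid defect `𝔇((Σ∇′*∇′)G₀′, (Σ∇*∇)G₀)` on the torus of record (88R) -/

/-- ★★★ **THE TWO-GRID η-DEFECT OF ENTRY 3 OF THE COVER's PARAMETRIX ON THE TORUS OF RECORD**: for odd `L ≥ 3`, `a > 0` there are `δ, D > 0` — free of the cube exponent `s`, the
volume exponent `m_T ≥ s + 1`, `K ≥ 1` (`4 ≤ L^K`) and `r` — with `𝔇((Σ∇′*∇′)∘G₀′, (Σ∇*∇)∘G₀) ≤ D·(L^K)^{−1∕16}·e^{−δ|y−y′|_T}` (spacings `L^{−K}`, `L^{−(K+r)}` of `Tor(2L^{m_T})`, King's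
pairing) — FILE 83 `hasMaj_idef_comp_parametrix_of_commOp_h` with g4's fine weighted rows and their two-grid defect at the partition pair (fit `π(d+1)∕(L^K·L^s)`), FILE 72's fine
commutator rows (P-IId ∕ FILE 81 cut rows) and 87R's commutator defect, the true overlap `(L+1)^{d+1}`, compressed by FILE 87 `entryThreeDefectConst_le`.
[cite: Balaban1984PropagatorsII, (2.133)–(2.136) p.247 (shapes), (2.36)–(2.38) p.229, p.238 (T_□); Balaban1985BackgroundPropagators, Thm 3.14 pp.426–427 (difference template), (3.42) p.397
(entry 3: shape); King1986, Prop. 3.9 (3.73) p.665 (rate shape)] -/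
theorem hasMaj_idef_lap_parametrix_knitR (hL : Odd L ∧ 1 < L) {a : ℝ} (ha : 0 < a) :
    ∃ δ D : ℝ, 0 < δ ∧ 0 < D ∧ ∀ (s mT K r : ℕ) (hs : s + 1 ≤ mT) (_hK : 1 ≤ K) (_hn4 : 4 ≤ L ^ K),
      HasMaj (BlockNorm.ofBlocks (unitTorusGeo L K (MP (paramsOf d L mT K hL)))
          (fun b : Tor (fine (L ^ K) (MP (paramsOf d L mT K hL))) × Fin (d + 1) => blockOf (L ^ K) (MP (paramsOf d L mT K hL)) b.1))
        (BlockNorm.ofBlocks (unitTorusGeo L K (MP (paramsOf d L mT K hL)))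
          (fun i : Tor (fine (L ^ r * L ^ K) (MP (paramsOf d L mT K hL))) × Fin (d + 1) => blockOf (L ^ r * L ^ K) (MP (paramsOf d L mT K hL)) i.1))
        (idef (pull (kingPrV L K r (MP (paramsOf d L mT K hL)))) (pull (kingPrV L K r (MP (paramsOf d L mT K hL))))
          (lapOp ((L ^ r * L ^ K : ℕ) : ℝ) (bshiftEquiv (MP (paramsOf d L mT K hL)) (L ^ r * L ^ K)) 0 ∘ₗ
            parametrix (knitHR d L s mT K (L ^ r * L ^ K) hL) (knitGR d L s mT K (L ^ r * L ^ K) hL hs a))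
          (lapOp ((L ^ K : ℕ) : ℝ) (bshiftEquiv (MP (paramsOf d L mT K hL)) (L ^ K)) 0 ∘ₗ
            parametrix (knitHR d L s mT K (L ^ K) hL) (knitGR d L s mT K (L ^ K) hL hs a)))
        (fun y y' => D * ((L ^ K : ℕ) : ℝ) ^ (-(1 / 16 : ℝ)) * Real.exp (-(δ * tdistT (MP (paramsOf d L mT K hL)) y y'))) := by
  have hL3 : 3 ≤ L := by obtain ⟨⟨j, hj⟩, h1⟩ := hL; omega
  have hLpos : 0 < L := by omega
  -- the letters, all uniform in the volume
  obtain ⟨δE, βE, hδE, hβE, HE⟩ := hasMaj_mulOp_lap_liftCubeG_pair (d := d) hL ha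
  obtain ⟨δG, βG, hδG, hβG, HG⟩ := hasMaj_chiCube_liftCubeG_fine (d := d) hL ha
  obtain ⟨δD, βD, hδD, hβD, HD⟩ := liftCubeG_grad_row_fine (d := d) hL ha
  obtain ⟨δB, βB, hδB, hβB, HB⟩ := hasMaj_chiCube_divAdjOut_liftCubeG_pair (d := d) hL ha
  obtain ⟨δ3, m3, hδ3, hm3, H3⟩ := hasMaj_idef_mulOp_lap_liftCubeG (d := d) hL ha (γ := 1 / 8) (by norm_num) (by norm_num)
  obtain ⟨δ7, Cr, hδ7, hCr, H7⟩ := hasMaj_idef_commOp_lapOp_comp_knitGR (d := d) hL ha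
  set δ : ℝ := min (min (min δE δG) (min δD δB)) (min δ3 δ7) with hδ_def
  have hδ : 0 < δ := lt_min (lt_min (lt_min hδE hδG) (lt_min hδD hδB)) (lt_min hδ3 hδ7)
  have hdE : δ ≤ δE := (min_le_left _ _).trans ((min_le_left _ _).trans (min_le_left _ _))
  have hdG : δ ≤ δG := (min_le_left _ _).trans ((min_le_left _ _).trans (min_le_right _ _))
  have hdD : δ ≤ δD := (min_le_left _ _).trans ((min_le_right _ _).trans (min_le_left _ _))
  have hdB : δ ≤ δB := (min_le_left _ _).trans ((min_le_right _ _).trans (min_le_right _ _))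
  have hd3 : δ ≤ δ3 := (min_le_right _ _).trans (min_le_left _ _)
  have hd7 : δ ≤ δ7 := (min_le_right _ _).trans (min_le_right _ _)
  set β₁ : ℝ := max βD βB with hβ₁_def
  have hβ₁ : 0 ≤ β₁ := hβD.le.trans (le_max_left _ _)
  set Θ : ℝ := (d + 1 : ℕ) * (32 * π ^ 2 * βG + 2 * (π * β₁)) with hΘ_def
  have hΘ : 0 ≤ Θ := by positivity
  set Nov : ℝ := ((((L + 1) ^ (d + 1) : ℕ)) : ℝ) with hNov_def
  have hNov : 0 ≤ Nov := by positivity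
  set Ko : ℝ := π * (d + 1) with hKo_def
  set m3K : ℝ := m3 * (Ko + 1) with hm3K_def
  have hm3K0 : 0 ≤ m3K := by positivity
  set D : ℝ := Nov * ((βE * Ko + m3K) + (Θ * Ko + Cr)) + 1 with hD_def
  refine ⟨δ, D, hδ, by positivity, fun s mT K r hs hK hn4 => ?_⟩
  set M : Fin (d + 1) → ℕ := MP (paramsOf d L mT K hL) with hMdef
  have hs' : s ≤ mT := by omega
  have hM : ∀ ν, M ν = 2 * L ^ (mT - s) * L ^ s := MP_eq_two_mul L s mT K hL hs'
  have hw : 0 < L ^ s := pow_pos hLpos s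
  haveI : NeZero (L ^ (mT - s)) := ⟨pow_ne_zero _ (NeZero.ne L)⟩
  have hn : 1 ≤ L ^ K := Nat.one_le_pow _ _ hLpos
  have hwR : (1 : ℝ) ≤ ((L ^ s : ℕ) : ℝ) := by exact_mod_cast hw
  have hnR : (1 : ℝ) ≤ ((L ^ K : ℕ) : ℝ) := by exact_mod_cast hn
  have hSe : L ^ (s + 1) = L * L ^ s := by rw [pow_succ, mul_comm]
  have hfit : 2 * coverMargin L s + 2 * L ^ s + 1 ≤ L ^ (s + 1) := by rw [hSe]; exact coverMargin_fit hL3 s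
  have hfit1 : coverMargin L s + 2 * L ^ s + 1 ≤ L ^ (s + 1) := by omega
  have hS : L ^ (s + 1) ≤ 2 * L ^ (mT - s) * L ^ s := by
    rw [← hM 0]
    show L ^ (s + 1) ≤ 2 * L ^ mT
    have := Nat.pow_le_pow_right hLpos hs
    omega
  set ε : ℝ := ((L ^ K : ℕ) : ℝ) ^ (-(1 / 16 : ℝ)) with hε_def
  obtain ⟨-, hnwε, -, hε0⟩ := rpow_sixteenth_facts hnR hwR
  have hexp16 : (-((1 : ℝ) / 8 / 2)) = -(1 / 16 : ℝ) := by norm_num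
  set o : ℝ := π * (d + 1) / (((L ^ K : ℕ) : ℝ) * ((L ^ s : ℕ) : ℝ)) with ho_def
  have ho : 0 ≤ o := by positivity
  have hoK : o ≤ Ko * ε := by rw [ho_def, div_eq_mul_inv]; exact mul_le_mul_of_nonneg_left hnwε (by positivity)
  have hm3le : m3 * (o + ε) ≤ m3K * ε := by
    rw [hm3K_def]
    calc m3 * (o + ε) ≤ m3 * (Ko * ε + ε) := mul_le_mul_of_nonneg_left (by linarith) hm3.le
      _ = m3 * (Ko + 1) * ε := by ring
  have hblk : (fun i : Tor (fine (L ^ r * L ^ K) M) × Fin (d + 1) => blockOf (L ^ r * L ^ K) M i.1) =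
      (fun b : Tor (fine (L ^ K) M) × Fin (d + 1) => blockOf (L ^ K) M b.1) ∘ kingPrV L K r M := (blkFine_comp_kingPrV (M := M) L K r).symm
  have hind : ∀ (k : Fin (d + 1) → ZMod (2 * L ^ (mT - s))) (y y' : Tor M),
      0 ≤ ind (g := unitTorusGeo L K M) ((cubeBlocks M (coverCorner M (L ^ s) (L ^ (mT - s)) (coverMargin L s) k) (L ^ (s + 1)) : Finset (Tor M)) : Set (Tor M)) y *
        ind (g := unitTorusGeo L K M) ((cubeBlocks M (coverCorner M (L ^ s) (L ^ (mT - s)) (coverMargin L s) k) (L ^ (s + 1)) : Finset (Tor M)) : Set (Tor M)) y' :=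
    fun k y y' => mul_nonneg (ind_nonneg _ _) (ind_nonneg _ _)
  have hint : ∀ (n : ℕ) [NeZero n] (k : Fin (d + 1) → ZMod (2 * L ^ (mT - s))) (b : Tor (fine n M) × Fin (d + 1)), knitHR d L s mT K n hL k b ≠ 0 →
      b ∈ TwoGrid.intBonds M n (coverCorner M (L ^ s) (L ^ (mT - s)) (coverMargin L s) k) (L ^ (s + 1)) := fun n _ k b hb =>
    mem_intBonds_of_hcube_ne_zero_side (m₀ := coverMargin L s) hM hw hfit1 hS hb
  -- the fine weighted rows (g4) on the fine blocks read through the pairing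
  have hE3 : ∀ k : Fin (d + 1) → ZMod (2 * L ^ (mT - s)),
      HasMaj (BlockNorm.ofBlocks (unitTorusGeo L K M) ((fun b : Tor (fine (L ^ K) M) × Fin (d + 1) => blockOf (L ^ K) M b.1) ∘ kingPrV L K r M))
        (BlockNorm.ofBlocks (unitTorusGeo L K M) ((fun b : Tor (fine (L ^ K) M) × Fin (d + 1) => blockOf (L ^ K) M b.1) ∘ kingPrV L K r M))
        (mulOp (knitHR d L s mT K (L ^ r * L ^ K) hL k) ∘ₗ (lapOp ((L ^ r * L ^ K : ℕ) : ℝ) (bshiftEquiv M (L ^ r * L ^ K)) 0 ∘ₗ knitGR d L s mT K (L ^ r * L ^ K) hL hs a k))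
        (fun y y' => ind ((cubeBlocks M (coverCorner M (L ^ s) (L ^ (mT - s)) (coverMargin L s) k) (L ^ (s + 1)) : Finset (Tor M)) : Set (Tor M)) y *
          ind ((cubeBlocks M (coverCorner M (L ^ s) (L ^ (mT - s)) (coverMargin L s) k) (L ^ (s + 1)) : Finset (Tor M)) : Set (Tor M)) y' * (βE * Real.exp (-(δ * tdistT M y y')))) :=
    fun k => by
    rw [← hblk]
    exact hasMaj_rate_le (hind k) hβE.le hdE
      ((HE (s + 1) mT K r hs hK (coverCorner M (L ^ s) (L ^ (mT - s)) (coverMargin L s) k)).2 (knitHR d L s mT K (L ^ r * L ^ K) hL k)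
        (hint (L ^ r * L ^ K) k) (fun b => abs_coverH_le_one k b))
  -- the fine cut rows (P-IId, FILE 81) and FILE 72's fine commutator rows
  have hGc' : ∀ k : Fin (d + 1) → ZMod (2 * L ^ (mT - s)),
      HasMaj (BlockNorm.ofBlocks (unitTorusGeo L K M) (fun i : Tor (fine (L ^ r * L ^ K) M) × Fin (d + 1) => blockOf (L ^ r * L ^ K) M i.1))
        (BlockNorm.ofBlocks (unitTorusGeo L K M) (fun i : Tor (fine (L ^ r * L ^ K) M) × Fin (d + 1) => blockOf (L ^ r * L ^ K) M i.1))
        (mulOp (chiCube M (L ^ r * L ^ K) (coverCorner M (L ^ s) (L ^ (mT - s)) (coverMargin L s) k) (L ^ (s + 1))) ∘ₗ knitGR d L s mT K (L ^ r * L ^ K) hL hs a k)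
        (fun y y' => ind ((cubeBlocks M (coverCorner M (L ^ s) (L ^ (mT - s)) (coverMargin L s) k) (L ^ (s + 1)) : Finset (Tor M)) : Set (Tor M)) y *
          ind ((cubeBlocks M (coverCorner M (L ^ s) (L ^ (mT - s)) (coverMargin L s) k) (L ^ (s + 1)) : Finset (Tor M)) : Set (Tor M)) y' * (βG * Real.exp (-(δ * tdistT M y y')))) :=
    fun k => hasMaj_rate_le (hind k) hβG.le hdG (HG (s + 1) mT K r hs hK (coverCorner M (L ^ s) (L ^ (mT - s)) (coverMargin L s) k))
  have hDc' : ∀ (k : Fin (d + 1) → ZMod (2 * L ^ (mT - s))) (μ : Fin (d + 1)),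
      HasMaj (BlockNorm.ofBlocks (unitTorusGeo L K M) (fun i : Tor (fine (L ^ r * L ^ K) M) × Fin (d + 1) => blockOf (L ^ r * L ^ K) M i.1))
        (BlockNorm.ofBlocks (unitTorusGeo L K M) (fun i : Tor (fine (L ^ r * L ^ K) M) × Fin (d + 1) => blockOf (L ^ r * L ^ K) M i.1))
        (mulOp (chiCube M (L ^ r * L ^ K) (coverCorner M (L ^ s) (L ^ (mT - s)) (coverMargin L s) k) (L ^ (s + 1))) ∘ₗ
          (fgrad ((L ^ r * L ^ K : ℕ) : ℝ) (bshiftEquiv M (L ^ r * L ^ K) μ) ∘ₗ knitGR d L s mT K (L ^ r * L ^ K) hL hs a k))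
        (fun y y' => ind ((cubeBlocks M (coverCorner M (L ^ s) (L ^ (mT - s)) (coverMargin L s) k) (L ^ (s + 1)) : Finset (Tor M)) : Set (Tor M)) y *
          ind ((cubeBlocks M (coverCorner M (L ^ s) (L ^ (mT - s)) (coverMargin L s) k) (L ^ (s + 1)) : Finset (Tor M)) : Set (Tor M)) y' * (β₁ * Real.exp (-(δ * tdistT M y y')))) :=
    fun k μ => by
    have h := HD (s + 1) mT K r hs hK (coverCorner M (L ^ s) (L ^ (mT - s)) (coverMargin L s) k) μ
    rw [symbOp_sD_eq] at h
    exact (hasMaj_rate_le (hind k) hβD.le hdD h).mono fun y y' =>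
      mul_le_mul_of_nonneg_left (mul_le_mul_of_nonneg_right (le_max_left _ _) (Real.exp_nonneg _)) (hind k y y')
  have hDbc' : ∀ (k : Fin (d + 1) → ZMod (2 * L ^ (mT - s))) (μ : Fin (d + 1)),
      HasMaj (BlockNorm.ofBlocks (unitTorusGeo L K M) (fun i : Tor (fine (L ^ r * L ^ K) M) × Fin (d + 1) => blockOf (L ^ r * L ^ K) M i.1))
        (BlockNorm.ofBlocks (unitTorusGeo L K M) (fun i : Tor (fine (L ^ r * L ^ K) M) × Fin (d + 1) => blockOf (L ^ r * L ^ K) M i.1))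
        (mulOp (chiCube M (L ^ r * L ^ K) (coverCorner M (L ^ s) (L ^ (mT - s)) (coverMargin L s) k) (L ^ (s + 1))) ∘ₗ
          (bgrad ((L ^ r * L ^ K : ℕ) : ℝ) (bshiftEquiv M (L ^ r * L ^ K) μ) ∘ₗ knitGR d L s mT K (L ^ r * L ^ K) hL hs a k))
        (fun y y' => ind ((cubeBlocks M (coverCorner M (L ^ s) (L ^ (mT - s)) (coverMargin L s) k) (L ^ (s + 1)) : Finset (Tor M)) : Set (Tor M)) y *
          ind ((cubeBlocks M (coverCorner M (L ^ s) (L ^ (mT - s)) (coverMargin L s) k) (L ^ (s + 1)) : Finset (Tor M)) : Set (Tor M)) y' * (β₁ * Real.exp (-(δ * tdistT M y y')))) :=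
    fun k μ => by
    have h := (HB (s + 1) mT K r hs hK (coverCorner M (L ^ s) (L ^ (mT - s)) (coverMargin L s) k) μ).2
    rw [bgrad_eq_neg_symbOp, LinearMap.neg_comp, LinearMap.comp_neg]
    exact ((hasMaj_rate_le (hind k) hβB.le hdB h).mono fun y y' =>
      mul_le_mul_of_nonneg_left (mul_le_mul_of_nonneg_right (le_max_right _ _) (Real.exp_nonneg _)) (hind k y y')).neg
  have hKc' : ∀ k : Fin (d + 1) → ZMod (2 * L ^ (mT - s)),
      HasMaj (BlockNorm.ofBlocks (unitTorusGeo L K M) ((fun b : Tor (fine (L ^ K) M) × Fin (d + 1) => blockOf (L ^ K) M b.1) ∘ kingPrV L K r M))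
        (BlockNorm.ofBlocks (unitTorusGeo L K M) ((fun b : Tor (fine (L ^ K) M) × Fin (d + 1) => blockOf (L ^ K) M b.1) ∘ kingPrV L K r M))
        (commOp (lapOp ((L ^ r * L ^ K : ℕ) : ℝ) (bshiftEquiv M (L ^ r * L ^ K)) 0) (knitHR d L s mT K (L ^ r * L ^ K) hL k) ∘ₗ knitGR d L s mT K (L ^ r * L ^ K) hL hs a k)
        (fun y y' => ind ((cubeBlocks M (coverCorner M (L ^ s) (L ^ (mT - s)) (coverMargin L s) k) (L ^ (s + 1)) : Finset (Tor M)) : Set (Tor M)) y *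
          ind ((cubeBlocks M (coverCorner M (L ^ s) (L ^ (mT - s)) (coverMargin L s) k) (L ^ (s + 1)) : Finset (Tor M)) : Set (Tor M)) y' * (Θ * Real.exp (-(δ * tdistT M y y')))) := fun k => by
    rw [← hblk]
    have h := hasMaj_commOp_lapOp_comp_cover_of (L := L) (kk := K) (M := M) (n := L ^ r * L ^ K) hM hw hfit1 hS k (hGc' k) (hDc' k) (hDbc' k)
    refine h.mono fun y y' => mul_le_mul_of_nonneg_left (mul_le_mul_of_nonneg_right ?_ (Real.exp_nonneg _)) (hind k y y')
    have h32 : 32 * π ^ 2 / ((L ^ s : ℕ) : ℝ) ^ 2 * βG ≤ 32 * π ^ 2 * βG := by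
      refine mul_le_mul_of_nonneg_right (div_le_self (by positivity) ?_) hβG.le
      nlinarith
    have hπ : π / ((L ^ s : ℕ) : ℝ) * β₁ ≤ π * β₁ := mul_le_mul_of_nonneg_right (div_le_self Real.pi_pos.le hwR) hβ₁
    rw [hΘ_def, add_zero]
    exact mul_le_mul_of_nonneg_left (by linarith) (by positivity)
  -- the defects: the weighted row at the partition pair (g4) and the commutator (87R)
  have hIE3 : ∀ k : Fin (d + 1) → ZMod (2 * L ^ (mT - s)),
      HasMaj (BlockNorm.ofBlocks (unitTorusGeo L K M) (fun b : Tor (fine (L ^ K) M) × Fin (d + 1) => blockOf (L ^ K) M b.1))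
        (BlockNorm.ofBlocks (unitTorusGeo L K M) ((fun b : Tor (fine (L ^ K) M) × Fin (d + 1) => blockOf (L ^ K) M b.1) ∘ kingPrV L K r M))
        (idef (pull (kingPrV L K r M)) (pull (kingPrV L K r M))
          (mulOp (knitHR d L s mT K (L ^ r * L ^ K) hL k) ∘ₗ (lapOp ((L ^ r * L ^ K : ℕ) : ℝ) (bshiftEquiv M (L ^ r * L ^ K)) 0 ∘ₗ knitGR d L s mT K (L ^ r * L ^ K) hL hs a k))
          (mulOp (knitHR d L s mT K (L ^ K) hL k) ∘ₗ (lapOp ((L ^ K : ℕ) : ℝ) (bshiftEquiv M (L ^ K)) 0 ∘ₗ knitGR d L s mT K (L ^ K) hL hs a k)))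
        (fun y y' => ind ((cubeBlocks M (coverCorner M (L ^ s) (L ^ (mT - s)) (coverMargin L s) k) (L ^ (s + 1)) : Finset (Tor M)) : Set (Tor M)) y *
          ind ((cubeBlocks M (coverCorner M (L ^ s) (L ^ (mT - s)) (coverMargin L s) k) (L ^ (s + 1)) : Finset (Tor M)) : Set (Tor M)) y' * (m3K * ε * Real.exp (-(δ * tdistT M y y')))) :=
    fun k => by
    have h := H3 (s + 1) mT K r hs hK (coverCorner M (L ^ s) (L ^ (mT - s)) (coverMargin L s) k) (knitHR d L s mT K (L ^ K) hL k) (knitHR d L s mT K (L ^ r * L ^ K) hL k) ho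
      (hint (L ^ K) k) (fun b => abs_coverH_le_one k b) (hint (L ^ r * L ^ K) k) (fun b => abs_coverH_le_one k b)
      (fun x' => abs_coverH_fine_sub_le (L := L) (kk := K) (r := r) hM hw k x')
    rw [hexp16] at h
    have h2 := (hasMaj_rate_le (hind k) (by positivity : 0 ≤ m3 * (o + ε)) hd3 h).mono fun y y' =>
      mul_le_mul_of_nonneg_left (mul_le_mul_of_nonneg_right hm3le (Real.exp_nonneg _)) (hind k y y')
    rw [hblk] at h2
    exact h2
  have hDK : ∀ k : Fin (d + 1) → ZMod (2 * L ^ (mT - s)),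
      HasMaj (BlockNorm.ofBlocks (unitTorusGeo L K M) (fun b : Tor (fine (L ^ K) M) × Fin (d + 1) => blockOf (L ^ K) M b.1))
        (BlockNorm.ofBlocks (unitTorusGeo L K M) ((fun b : Tor (fine (L ^ K) M) × Fin (d + 1) => blockOf (L ^ K) M b.1) ∘ kingPrV L K r M))
        (idef (pull (kingPrV L K r M)) (pull (kingPrV L K r M))
          (commOp (lapOp ((L ^ r * L ^ K : ℕ) : ℝ) (bshiftEquiv M (L ^ r * L ^ K)) 0) (knitHR d L s mT K (L ^ r * L ^ K) hL k) ∘ₗ knitGR d L s mT K (L ^ r * L ^ K) hL hs a k)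
          (commOp (lapOp ((L ^ K : ℕ) : ℝ) (bshiftEquiv M (L ^ K)) 0) (knitHR d L s mT K (L ^ K) hL k) ∘ₗ knitGR d L s mT K (L ^ K) hL hs a k))
        (fun y y' => ind ((cubeBlocks M (coverCorner M (L ^ s) (L ^ (mT - s)) (coverMargin L s) k) (L ^ (s + 1)) : Finset (Tor M)) : Set (Tor M)) y *
          ind ((cubeBlocks M (coverCorner M (L ^ s) (L ^ (mT - s)) (coverMargin L s) k) (L ^ (s + 1)) : Finset (Tor M)) : Set (Tor M)) y' * (Cr * ε * Real.exp (-(δ * tdistT M y y')))) :=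
    fun k => by
    have h := hasMaj_rate_le (hind k) (by positivity : 0 ≤ Cr * ε) hd7 (H7 s mT K r hs hK hn4 k)
    rw [hblk] at h
    exact h
  -- the partition: size, two-grid fit, the cover's true overlap
  have hh : ∀ (k : Fin (d + 1) → ZMod (2 * L ^ (mT - s))) x, |knitHR d L s mT K (L ^ K) hL k x| ≤ 1 := fun k x => abs_coverH_le_one k x
  have hfitH : ∀ (k : Fin (d + 1) → ZMod (2 * L ^ (mT - s))) x', |knitHR d L s mT K (L ^ r * L ^ K) hL k x' - knitHR d L s mT K (L ^ K) hL k (kingPrV L K r M x')| ≤ o :=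
    fun k x' => abs_coverH_fine_sub_le (L := L) (kk := K) (r := r) hM hw k x'
  have hNovEq : L ^ (s + 1) / L ^ s + 1 = L + 1 := by rw [pow_succ, Nat.mul_div_cancel_left L hw]
  have hN : ∀ y : Tor M, ∑ k : Fin (d + 1) → ZMod (2 * L ^ (mT - s)),
      ind (g := unitTorusGeo L K M) ((cubeBlocks M (coverCorner M (L ^ s) (L ^ (mT - s)) (coverMargin L s) k) (L ^ (s + 1)) : Finset (Tor M)) : Set (Tor M)) y ≤ Nov := fun y => by
    have := sum_ind_cubeBlocks_le_overlap (M := M) (w := L ^ s) (q := L ^ (mT - s)) (m₀ := coverMargin L s) (S := L ^ (s + 1)) hM hw L K y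
    rwa [hNovEq] at this
  -- FILE 83
  have key := hasMaj_idef_comp_parametrix_of_commOp_h (g := unitTorusGeo L K M) (fun b : Tor (fine (L ^ K) M) × Fin (d + 1) => blockOf (L ^ K) M b.1) (kingPrV L K r M)
    (fun k => ((cubeBlocks M (coverCorner M (L ^ s) (L ^ (mT - s)) (coverMargin L s) k) (L ^ (s + 1)) : Finset (Tor M)) : Set (Tor M)))
    (D₃ := lapOp ((L ^ K : ℕ) : ℝ) (bshiftEquiv M (L ^ K)) 0) (D₃' := lapOp ((L ^ r * L ^ K : ℕ) : ℝ) (bshiftEquiv M (L ^ r * L ^ K)) 0)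
    (h := knitHR d L s mT K (L ^ K) hL) (h' := knitHR d L s mT K (L ^ r * L ^ K) hL) (G := knitGR d L s mT K (L ^ K) hL hs a) (G' := knitGR d L s mT K (L ^ r * L ^ K) hL hs a)
    hβE.le hΘ ho (by positivity : 0 ≤ m3K * ε) (by positivity : 0 ≤ Cr * ε) hh hfitH hN hE3 hKc' hIE3 hDK
  rw [← hblk] at key
  refine key.mono fun y y' => mul_le_mul_of_nonneg_right ?_ (Real.exp_nonneg _)
  have hcomp := entryThreeDefectConst_le (m₃ := m3K) (Cr := Cr) hNov hβE.le hΘ hoK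
  refine hcomp.trans ?_
  rw [hD_def, add_mul _ (1 : ℝ) ε, one_mul]
  exact le_add_of_nonneg_right hε0

end Summit.QuantumFields.YangMills.BalabanUVNodes.N15.Gluing

end
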